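import Summits.QuantumAdvantage.QuantumAdvantage.Theses.WhiteBoxWalk
import Literature.Computability.Cryptography.Shor
import Literature.Computability.Cryptography.ShorAssemblyLeavesProofs
import Literature.Computability.QuantumComplexity.Factoring
import Literature.Computability.Complexity.BoolEncodings

/-!
# Sketch — crux `WbwThesis` (stmt-QuantumAdvantage-2238), crux-ideate round 1, ideator 3

First-lemma shapes for the two idea cards filed by this seat:

* `planted-semiprime-shor`  — X ⟸ `FactAvgHard` (standard average-case factoring assumption on
  uniform pairs of `n`-bit primes), with clause (Q) FREE from the tree's discharged Shor theorem
  (`clauseQ_factorAns`, PROVED below for every generator) and the planting done by first-hit scanning of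
  seed blocks with the tree's PROVED `PRIMES ∈ P`.
* `product-refinement-amplification` — the transfer `WbwThesisWeak → WbwThesis` (inverse-polynomial
  classical failure + seed-computable answers suffice: weakly-verifiable-puzzle direct product on the
  classical side, pseudo-deterministic majority on the quantum side), instantiated by the UNPLANTED
  multiplication generator `multGen` (no primality test anywhere) under the WEAK factoring assumption,
  where verification inside the direct-product reduction is replaced by gcd-refinement.

Nothing here asserts the crux; conjecture-grade statements are `def … : Prop`.
-/

set_option linter.dupNamespace false

noncomputable section

namespace Summit.QuantumAdvantage.QuantumAdvantage.Cruxes.WbwThesis.IdeasR1K3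

open Filter Asymptotics _root_.Computability
open Literature.Computability.Complexity Literature.Computability.Cryptography
open Summit.QuantumAdvantage.QuantumAdvantage.Theses

/-! ### The clauses of X, named -/

/-- Clause (Q) of `WbwThesis` for a pair `(gen, ans)`: ONE uniform oracle-free Clifford+T family outputs
`ans s` as a prefix on input `gen s`, with probability `≥ 2/3`, for EVERY seed. -/
def ClauseQ (gen ans : List Bool → List Bool) : Prop :=
  ∃ F : QCircuitFamily cliffordT, F.IsOracleFree ∧ F.IsUniform ∧
    ∀ s, 2 / 3 ≤ F.kernelProb 0 (gen s) {y | ans s <+: y}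

/-- Clause (C) of `WbwThesis`: every PPT, given `(1ⁿ, gen s)` for uniform `s ∈ {0,1}ⁿ`, outputs `ans s`
with negligible probability. -/
def ClauseC (gen ans : List Bool → List Bool) : Prop :=
  ∀ A : RandAlg (List Bool) (List Bool), IsPPT A id →
    SuperpolynomialDecay atTop (fun n : ℕ => (n : ℝ)) (fun n : ℕ =>
      uniformAvg n fun s => A.pr id (boolPair (unaryEncodeNat n) (gen s)) {y | ans s <+: y})

/-- The length law `|ans s| = p(|gen s|)`. -/
def LengthLaw (gen ans : List Bool → List Bool) : Prop :=
  ∃ p : Polynomial ℕ, ∀ s, (ans s).length = p.eval (gen s).length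

/-- X is literally the conjunction of the four clauses (sanity: the sketch's vocabulary is the crux's). -/
theorem wbwThesis_of_clauses {gen ans : List Bool → List Bool}
    (hg : PolyTimeComputable id id gen) (hl : LengthLaw gen ans)
    (hQ : ClauseQ gen ans) (hC : ClauseC gen ans) : WhiteBoxWalk.WbwThesis :=
  ⟨gen, ans, hg, hl, hQ, hC⟩

/-! ### Card `planted-semiprime-shor`: (Q) is free for answers that factor through an FBQP map -/

/-- If the answer is `f (gen s)` with `f ∈ FBQP`, clause (Q) holds for EVERY generator and EVERY seed —
no property of `gen` is used (this is why the planting may be "flagless"). -/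
theorem clauseQ_of_mem_FBQP {f : List Bool → List Bool} (hf : f ∈ FBQP)
    (gen : List Bool → List Bool) : ClauseQ gen (f ∘ gen) := by
  have hf' : IsQSolvable fun x => {y | f x <+: y} := hf
  obtain ⟨F, h1, h2, h3⟩ := hf'
  exact ⟨F, h1, h2, fun s => h3 (gen s)⟩

/-- The factoring answer map: Boolean code of the sorted prime factorisation of the decoded instance. -/
def factorAns : List Bool → List Bool :=
  fun x => encodingListNatBool.encode (decodeNat x).primeFactorsList

/-- **(Q) for the factorisation answer, PROVED for every generator** from the tree's discharged Shor
theorem `factoring_mem_FBQP_holds`. -/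
theorem clauseQ_factorAns (gen : List Bool → List Bool) : ClauseQ gen (factorAns ∘ gen) :=
  clauseQ_of_mem_FBQP factoring_mem_FBQP_holds gen

/-- Pairs of `n`-bit primes `p ≤ q` (top bit set). -/
def primePairs (n : ℕ) : Finset (ℕ × ℕ) :=
  ((Finset.Ico (2 ^ (n - 1)) (2 ^ n)) ×ˢ (Finset.Ico (2 ^ (n - 1)) (2 ^ n))).filter
    fun pq => pq.1.Prime ∧ pq.2.Prime ∧ pq.1 ≤ pq.2

/-- Average of `g` over uniform pairs of `n`-bit primes. -/
def primePairAvg (n : ℕ) (g : ℕ → ℕ → ℝ) : ℝ :=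
  (∑ pq ∈ primePairs n, g pq.1 pq.2) / (primePairs n).card

/-- CONJECTURE STUB (the standard factoring assumption, average case, uniform `n`-bit prime pairs):
every PPT given `(1ⁿ, p·q)` outputs the code of `[p, q]` with negligible probability. Quantumly FALSE
(Shor) — as the quantum-shadow obstruction of crux 2340 demands of the classical-only ingredient. -/
def FactAvgHard : Prop :=
  ∀ A : RandAlg (List Bool) (List Bool), IsPPT A id →
    SuperpolynomialDecay atTop (fun n : ℕ => (n : ℝ)) (fun n : ℕ =>
      primePairAvg n fun p q =>
        A.pr id (boolPair (unaryEncodeNat n) (encodeNat (p * q)))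
          {y | encodingListNatBool.encode [p, q] <+: y})

/-- First-hit planting: scan the `B` consecutive `m`-bit blocks of `s` and return the first block whose
value is an `m`-bit prime (top bit set), if any. (`gen` of the card = product of the first hits of the
two halves of the seed, zero-padded to `2m` bits; a seed with no hit in some half is answered by the
factorisation of whatever `gen` outputs — (Q) needs no flag, by `clauseQ_factorAns`.) -/
def firstPrimeBlock (m : ℕ) : List (List Bool) → Option ℕ
  | [] => none
  | b :: bs => if 2 ^ (m - 1) ≤ bitsToNat b ∧ (bitsToNat b).Prime then some (bitsToNat b)
      else firstPrimeBlock m bs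

/-- KEY PLANTING LEMMA (shape): conditioned on success, the first hit among i.i.d. uniform blocks is
UNIFORM on the `m`-bit primes — so the planted law is exactly the law of `FactAvgHard` up to the
failure event. Stated for one half: the number of block-lists of `B` blocks whose first hit is a given
prime `p` does not depend on `p`. -/
def FirstHitUniform : Prop :=
  ∀ m B : ℕ, ∀ p p' : ℕ, 2 ^ (m - 1) ≤ p → p < 2 ^ m → p.Prime → 2 ^ (m - 1) ≤ p' → p' < 2 ^ m →
    p'.Prime →
    ((Finset.univ.filter fun v : List.Vector (List.Vector Bool m) B =>
        firstPrimeBlock m (v.toList.map List.Vector.toList) = some p).card =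
     (Finset.univ.filter fun v : List.Vector (List.Vector Bool m) B =>
        firstPrimeBlock m (v.toList.map List.Vector.toList) = some p').card)

/-- DENSITY LEMMA (shape; from the tree's PNT `primeCounting_isEquivalent_holds`): eventually at least
`2^m / (2m)` primes have exactly `m` bits, so `B = m²` blocks miss with probability `≤ (1 - 1/(2m))^{m²}`,
negligible. -/
def PrimeWindowDensity : Prop :=
  ∀ᶠ m : ℕ in atTop, (2 : ℝ) ^ m / (2 * m) ≤ ((Nat.primeCounting (2 ^ m - 1) : ℝ) -
    Nat.primeCounting (2 ^ (m - 1) - 1))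

/-- The line of card `planted-semiprime-shor`, as one implication to be split into stubs by crux-plan:
`FirstHitUniform → PrimeWindowDensity → FactAvgHard → X`. -/
def PlantedSemiprimeLine : Prop :=
  FirstHitUniform → PrimeWindowDensity → FactAvgHard → WhiteBoxWalk.WbwThesis

/-! ### Card `product-refinement-amplification`: the weak form of X and the transfer -/

/-- `X_weak`: as X, but (i) the answer is polynomial-time computable FROM THE SEED (seed-verifiable
puzzle, Canetti–Halevi–Steiner) and (ii) classical solvers only FAIL WITH INVERSE-POLYNOMIAL probability. -/
def WbwThesisWeak : Prop :=
  ∃ (gen ans : List Bool → List Bool), PolyTimeComputable id id gen ∧ PolyTimeComputable id id ans ∧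
    LengthLaw gen ans ∧ ClauseQ gen ans ∧
    ∃ q : Polynomial ℕ, (∀ n, 0 < q.eval n) ∧
      ∀ A : RandAlg (List Bool) (List Bool), IsPPT A id →
        ∀ᶠ n in atTop,
          uniformAvg n (fun s => A.pr id (boolPair (unaryEncodeNat n) (gen s)) {y | ans s <+: y})
            ≤ 1 - 1 / ((q.eval n : ℕ) : ℝ)

/-- THE TRANSFER (card's C⁺ → C): direct product of seed-verifiable puzzles + pseudo-deterministic
majority. -/
def DirectProductTransfer : Prop :=
  WbwThesisWeak → WhiteBoxWalk.WbwThesis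

/-- The UNPLANTED multiplication generator: split the seed in halves and multiply (no primality test). -/
def multGen : List Bool → List Bool :=
  fun s => encodeNat (bitsToNat (s.take (s.length / 2)) * bitsToNat (s.drop (s.length / 2)))

/-- WEAK factoring assumption: some polynomial `q` such that every PPT fails to factor a uniform
`n`-bit prime pair with probability at least `1/q(n)`, eventually. -/
def FactWeakHard : Prop :=
  ∃ q : Polynomial ℕ, (∀ n, 0 < q.eval n) ∧
    ∀ A : RandAlg (List Bool) (List Bool), IsPPT A id →
      ∀ᶠ n in atTop,
        primePairAvg n (fun p q =>
            A.pr id (boolPair (unaryEncodeNat n) (encodeNat (p * q)))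
              {y | encodingListNatBool.encode [p, q] <+: y})
          ≤ 1 - 1 / ((q.eval n : ℕ) : ℝ)

/-- (C_weak) for the unplanted generator: every PPT fails to output the full factorisation of
`multGen s`, `s` uniform of even length, with probability `≥ 1/q'(n)` — from `FactWeakHard` and the
prime-pair density `≥ c/n²` (conditioning on both halves prime gives exactly the uniform prime-pair law). -/
def MultWeakHard : Prop :=
  ∃ q : Polynomial ℕ, (∀ n, 0 < q.eval n) ∧
    ∀ A : RandAlg (List Bool) (List Bool), IsPPT A id →
      ∀ᶠ n in atTop,
        uniformAvg (2 * n) (fun s =>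
            A.pr id (boolPair (unaryEncodeNat (2 * n)) (multGen s)) {y | factorAns (multGen s) <+: y})
          ≤ 1 - 1 / ((q.eval n : ℕ) : ℝ)

/-- First checkable statement of the card's instance: density + weak factoring ⇒ (C_weak) for `multGen`. -/
def MultWeakHardOfFactWeakHard : Prop :=
  PrimeWindowDensity → FactWeakHard → MultWeakHard

/-- REFINEMENT (the factoring-specific substitute for verification inside the direct-product reduction):
a list of factor-lists for `N` is refined by pairwise gcds; if one of the lists is the prime
factorisation, the common refinement of all VALID lists (product `= N`) is the prime factorisation.
Shape of the lemma over `List ℕ`: -/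
def RefinementTop : Prop :=
  ∀ (N : ℕ) (ls : List (List ℕ)), (∀ l ∈ ls, l.prod = N) → (N.primeFactorsList ∈ ls) →
    ∀ l ∈ ls, ∀ d ∈ l, ∃ sub : List ℕ, sub.prod = d ∧ ∀ r ∈ sub, r ∈ N.primeFactorsList

/-- The line of card `product-refinement-amplification` for the concrete instance:
`MultWeakHard → X` (k-fold product of `multGen`, concatenated padded answers; classical side = Yao-type
direct product with gcd-refinement in place of verification; quantum side = blockwise Shor + majority). -/
def RefinementAmplificationLine : Prop :=
  MultWeakHard → WhiteBoxWalk.WbwThesis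

end Summit.QuantumAdvantage.QuantumAdvantage.Cruxes.WbwThesis.IdeasR1K3
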